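/-
Copyright: lit-balaban cell, Phase-2 proof seat p33 (gen 13).  Statement-level skeleton of a published paper; no proof claims beyond
what the kernel checks below.
-/
import Literature.MathematicalPhysics.QuantumFieldTheory.Balaban1983to89.B4TorusPairFam

/-!
# `BalabanImbrieJaffe1984to88.BIJ85GlobalGaugeObstruction326` — [BalabanImbrieJaffe1985] Sect. 7.3 p. 326 × [Balaban1983RegularityDecay]
# (1.7) p. 572–573 on the torus: **THE FLUX OBSTRUCTION TO A GLOBAL REGULAR GAUGE** — a (1.7)-regular vector field on the WHOLE torus `T_η`
# has zero flux through every coordinate 2-torus (for `e` small), whereas small-curvature `U(1)` fields of nonzero flux exist; hence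
# [7]'s torus Theorem with `Ω₀ = T_η` (r01's `B4ThmTorusPairEta.thmPrintedNN_torusPairFam`) cannot be fed with such backgrounds in ANY
# gauge and with ANY choice of logarithms — a kernel SCOPE WITNESS for the located residue of row C1.Eq7.3.1-7.3.2 (GAPS G-C1-05 ADD. 12)

statement-level skeleton of published theorems with citation tags; proofs where landed; nothing here is a claim about the Yang–Mills mass gap

PDFs held: `paper:balaban1985-cmp97-bij-higgs-minimizers` (journal page = PDF page + 298), p. 326 [PDF 28]; `paper:balaban1983-cmp89-regularity-decay`
(journal page = PDF page + 570), pp. 572–573 [PDF 2–3].  Text layers re-read this session.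

CITATION HEADER (lean-in-tree rule).  Phase-2 file of the lit-balaban TYPED SKELETON (HOME `run/shared/lean/pub/lit-balaban/`), seat p33 gen 13
(unit `lit-balaban-p33-g13`; TAKING line HOME/STATUS.md 2026-08-22T09:37Z); SKELETON row **C1.Eq7.3.1-7.3.2** (owner r15, referee ref-5) ×
**B4.Thm@573** torus qualifier (owner r01).  KIND: scope witness (ours, disclosed as such) delimiting the reach of a printed hypothesis; every
declaration carries the citation tag of the display whose scope it concerns.  THE PRINTED TEXTS, verbatim.  [BalabanImbrieJaffe1985] p. 326:
*"In particular, let us assume that for the unit lattice field v, |v(∂p) − 1| ≤ e_k𝓅(e_k), (7.3.1) … The propagators arising from Δ_k(u_k), under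
the restriction (7.3.1) on the gauge field, also satisfy the regularity and decay estimates of [7]. In order to remain within the framework of
this reference, we remark that by change of gauge u_k can be transformed **in a local region Λ** into a configuration of the form exp[ie_kηA],
where A is smooth and small."*  [Balaban1983RegularityDecay] p. 572: *"Another common case is to consider operators on subsets of a torus T_η
which we identify with a rectangular parallelepiped in ηZ^d with periodic conditions. … We will consider vector fields A … regular in the
sense that |(∂^η_μA)(x)| ≤ ce^{β−1}, x ∈ Ω, μ = 1, …, d, β > 0 (1.7)"*; p. 573: *"… for e sufficiently small and for a regular vector field A …"*.

THE POINT OF THIS FILE.  r01's torus form of [7]'s Theorem (`B4ThmTorusPairEta.thmPrintedNN_torusPairFam`, row B4.Thm@573) is typed over the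
family `B4TorusPairFam.torusPairFam` whose hypothesis slot `regular` is (1.7) for the torus COMPONENT FIELD `A_ν(x)` (a function on the
representatives of `T_η`, read periodically through `twrap`) on `Ω₀`.  To obtain [7]'s estimates for [BalabanImbrieJaffe1985]'s WHOLE-TORUS
propagator `G_k(u_k)` one would need `Ω = Ω₀ = T_η` and a component field `A`, (1.7)-regular on ALL of `T_η`, whose link variables reproduce
`u_k` up to a lattice gauge transformation.  THIS FILE PROVES THAT SUCH AN `A` DOES NOT EXIST as soon as the background carries a nonzero flux
through some coordinate 2-torus — although its plaquette variables may be as close to `1` as one wishes — and that the obstruction is seen by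
the plaquette variables alone (so no gauge transformation and no other choice of logarithms helps):
* (§1–§2) for EVERY component field `A` on `T_η` the circulations `(dA)(p) = Δ_μA_ν − Δ_νA_μ` sum to ZERO over the plaquettes of a coordinate
  2-torus (discrete Stokes on a closed surface); hence the principal angles `θ_p ∈ (−π, π]` of the plaquette phases `e^{iκ(dA)(p)}` (`κ = eη`)
  sum to `2π·flux`, `flux ∈ ℤ`, and `flux` depends on the plaquette phases only;
* (§3) if all forward differences of `A` are `≤ r` with `2κr < π` — in particular if `A` is (1.7)-regular on `Ω₀ = T_η` (`r = ce^{β−1}η`,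
  `κ = eη`) and `2c·e^β < π·η^{−2}`, which holds for every `e ≤ (π/2c)^{1/β}` — then every `|κ(dA)(p)| < π` and `flux = 0`;
* (§4) the SEAM FIELD on `T_η` (directions `μ₀ ≠ ν₀`, fine periods `N₀, N₁`): every plaquette phase equals `e^{2πi/(N₀N₁)}` or `1`, and the
  `(μ₀, ν₀)`-flux is `1`;
* (§5) CONSEQUENCE IN r01's TYPED CURRENCY: for every `TorusPairInst` with `Ω₀ =` the whole torus, `0 < e`, `2c·e^β < π·n²`, whose component
  field has a nonzero flux — e.g. whose plaquette phases are the seam field's, in any gauge, with any logarithms — `(torusPairFam …).regular`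
  is FALSE (`not_regular_of_flux_ne_zero`, `not_regular_of_seamPhases`).
READING (why this is the located residue of C1.Eq7.3.1-7.3.2, not a defect of either paper).  (7.3.1) bounds the unit-lattice plaquette variables
only; on a unit torus with `N₀N₁·e_k𝓅(e_k) ≥ 2π` the seam construction at the unit level gives an admissible `v` with flux `1`, and the actual
background `u_k = Q^{s*}_kv·exp[−ie_kη(…)]` of (4.5.4) has the plaquette variables `v(∂p′)` on the faces of the unit plaquettes and `1` inside
blocks times an exact factor (`BIJ85Eq454Holonomy.plaq_background`, `BIJ85SmoothPotential326.plaq_actualBg_eq_exp_hodge`), so it inherits the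
flux (this last identification is a READING here, not a theorem of this file: the BIJ85 ↔ B4 whole-torus carrier dictionary is not built).
[BalabanImbrieJaffe1985] p. 326 itself only claims the LOCAL transformation («in a local region Λ»), which seat p33 gens 9–12 formalised
(`BIJ85LocalSmoothGauge326`, `BIJ85RegionPropagatorsActualBg*`: [7]'s theorem for the REGION family at `u_k`); the present file certifies that
the remaining «whole-torus» item of HOME/GAPS.md G-C1-05 ADDENDUM 12 is not reachable by instantiating [7]'s printed hypothesis globally — a
whole-torus version needs [7] under a LOCAL (gauge-covariant) regularity hypothesis, which is not what p. 573 prints.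

WHAT IS PROVED (0 `sorry`, standard axioms; theorems + five definitions with bodies `circ`, `pang`, `wind`, `flux`, `seamField`; no
`Prop`-valued definition, no named fact).
* §1 `circ` (the plaquette circulation `Δ_μA_ν − Δ_νA_μ` on representatives), `twrap_add_period`, **`sum_circ_section`** (discrete Stokes:
  `Σ_{p ∈ (μ,ν)-section} (dA)(p) = 0` for every component field).
* §2 `pang`/`wind` (principal angle in `(−π, π]` and winding integer: `pang φ + 2π·wind φ = φ`, `pang φ = arg e^{iφ}`), `pang_eq_of_cexp_eq`,
  `cexp_pang`, `norm_cexp_sub_one_le_abs_pang` (`‖e^{iφ} − 1‖ ≤ |pang φ|`); **`flux`** and **`flux_mul_two_pi`** (`2π·flux = Σ_p pang(κ(dA)(p))`),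
  `flux_eq_zero_of_abs_lt`, **`flux_eq_of_cexp_eq`** (the flux is a function of the plaquette phases), **`cexp_circ_eq_of_linkGauge`** (a
  lattice gauge transformation with any re-choice of logarithms preserves the plaquette phases).
* §3 `abs_circ_le`, **`flux_eq_zero_of_diffBound`** (forward differences `≤ r` on the whole torus and `2|κ|r < π` ⇒ flux `0`).
* §4 `seamField`, `kappa_circ_seam_plane` (`κ(dA)(p) ∈ {2π/(N₀N₁), 2π/(N₀N₁) − 2π}` in the plane), `cexp_circ_seam_plane`,
  `pang_circ_seam_plane`, **`flux_seam`** (`= 1`), `circ_seam_eq_zero_of_not_mem`, **`abs_pang_circ_seam_le`** and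
  **`norm_plaqVar_seam_sub_one_le`** (every plaquette angle / variable within `2π/(N₀N₁)` of `0` / `1`), `seam_plaqVar_le_of_large`
  (`‖u(∂p) − 1‖ ≤ ε` once `N₀N₁ ≥ 2π/ε`: the (7.3.1) shape).
* §5 `diffBound_of_regular` (r01's `(torusPairFam …).regular` with `Ω₀ = T_η` ⇒ the forward-difference bound `r = c e^{β−1}/n`),
  **`not_regular_of_flux_ne_zero`**, **`not_regular_of_seamPhases`**, **`exists_smallCurvature_flux_one`**, `cexp_eq_of_rot_eq` (dictionary
  `R(s) = R(t) ⇒ e^{is} = e^{it}` to r01's `OrthFlow.rot` currency).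
* §6 (v1.1, append-only) **`wholeTorus_hypotheses_unmet`** — non-vacuity in r01's own family, the counterpart of
  `B4ThmTorusPairEta.hypotheses_met`: for every `d + 1 ≥ 2`, `L`, windows, `(c, β)`, `K ≥ 1`, `M ≥ 3` and every `0 < e` with `2c·e^β < π`
  an explicit `TorusPairInst` at scale `k = 1` with `Ω = Ω₀ = T_η` (so `rect ∧ bigBlocks` hold) whose component field is the seam field:
  all plaquette variables within `2π/(LKM)²` of `1`, and `¬ regular`.
HONEST SCOPE.  Abelian (`U(1)`, phases `e^{iθ}`); r01's torus conventions (`B4TorusRegionOp`: representatives, `twrap`, `per`, component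
fields, `κ = e/n`); the link to r01's rotation-matrix currency `OrthFlow.rot` is the one-line dictionary `e^{is} = e^{it} ↔ R(s) = R(t)`
(`BIJ85RegionPropagatorsActualBg.rot_U_eq_of_circleExp_eq` and `rot_injective_mod` below); nothing about propagators is proved here.
Unit `lit-balaban-p33` (literature-prover-lit-balaban-p33-g13-0), 2026-08-22; v1.1 (§6 appended, §1–§5 byte-identical) same day.  NOT summit progress.
-/

open scoped BigOperators
open Finset

namespace Literature.MathematicalPhysics.QuantumFieldTheory.BalabanImbrieJaffe1984to88.BIJ85GlobalGaugeObstruction326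

open Literature.MathematicalPhysics.QuantumFieldTheory.Balaban1983to89
open Balaban1983to89.B4TorusRegionOp (per twrap twrap_twrap_add twrap_twrap twrap_eq_twrap_iff twrap_mem_boxDom twrap_eq_self twrap_apply)
open Balaban1983to89.B4Lower18Regular (e1 e1_apply_self e1_apply_ne)
open Balaban1983to89.B4Lower18 (fineDom)
open Balaban1983to89.B4Reflection242 (boxDom mem_boxDom)
open Balaban1983to89.B4TorusPairFam (TorusPairInst torusPairFam)
open Balaban1983to89.B4GaugeCovariance (OrthFlow)
open Complex (exp I arg)

noncomputable section

variable {d : ℕ}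

/-! ## §1  The plaquette circulation of a torus component field and discrete Stokes on a coordinate 2-torus -/

/-- the PLAQUETTE CIRCULATION (lattice curl, in units where the forward difference is undivided) of a torus component field `A_ν(x)` at the
plaquette `(x; μ, ν)`: `(dA)(x; μ, ν) = [A_ν(x + e_μ) − A_ν(x)] − [A_μ(x + e_ν) − A_μ(x)]`, read on representatives through `twrap` (so it is a
periodic function of `x ∈ ℤ^{d+1}`).  Its `κ`-multiple is the angle of the plaquette variable `U(A(∂p))` of the link variables `U(κA_b)` (1.2).
[cite: Balaban1983RegularityDecay, (1.2), (1.7) p.572] -/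
def circ (n : ℕ) (P : Fin (d + 1) → ℕ) (Ac : (Fin (d + 1) → ℤ) → Fin (d + 1) → ℝ) (x : Fin (d + 1) → ℤ) (μ ν : Fin (d + 1)) : ℝ :=
  (Ac (twrap n P (x + e1 μ)) ν - Ac (twrap n P x) ν) - (Ac (twrap n P (x + e1 ν)) μ - Ac (twrap n P x) μ)

/-- the circulation is antisymmetric in the plane. [cite: Balaban1983RegularityDecay, (1.2) p.572] -/
theorem circ_swap (n : ℕ) (P : Fin (d + 1) → ℕ) (Ac : (Fin (d + 1) → ℤ) → Fin (d + 1) → ℝ) (x : Fin (d + 1) → ℤ) (μ ν : Fin (d + 1)) :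
    circ n P Ac x ν μ = -circ n P Ac x μ ν := by
  unfold circ; ring

/-- a full period in one direction does not change the representative. [cite: Balaban1983RegularityDecay, p.572 «periodic conditions»] -/
theorem twrap_add_period (n : ℕ) (P : Fin (d + 1) → ℕ) (z : Fin (d + 1) → ℤ) (μ : Fin (d + 1)) :
    twrap n P (z + ((per n P μ : ℕ) : ℤ) • e1 μ) = twrap n P z := by
  rw [twrap_eq_twrap_iff]
  intro ν
  by_cases h : ν = μ
  · subst h; simp
  · simp [e1_apply_ne h]

/-- **DISCRETE STOKES ON A COORDINATE 2-TORUS**: for EVERY component field, the circulations of the `nP_μ × nP_ν` plaquettes of the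
`(μ, ν)`-coordinate 2-torus through `x` sum to zero (each bond of the closed surface is traversed twice, in opposite directions).
[cite: Balaban1983RegularityDecay, (1.7) p.572] -/
theorem sum_circ_section (n : ℕ) (P : Fin (d + 1) → ℕ) (Ac : (Fin (d + 1) → ℤ) → Fin (d + 1) → ℝ) (x : Fin (d + 1) → ℤ)
    (μ ν : Fin (d + 1)) :
    ∑ s ∈ range (per n P μ), ∑ t ∈ range (per n P ν), circ n P Ac (x + (s : ℤ) • e1 μ + (t : ℤ) • e1 ν) μ ν = 0 := by
  -- the two telescoping families
  set g : ℕ → ℕ → ℝ := fun t s => Ac (twrap n P (x + (t : ℤ) • e1 ν + (s : ℤ) • e1 μ)) ν with hg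
  set h : ℕ → ℕ → ℝ := fun s t => Ac (twrap n P (x + (s : ℤ) • e1 μ + (t : ℤ) • e1 ν)) μ with hh
  have hsplit : ∀ s t : ℕ, circ n P Ac (x + (s : ℤ) • e1 μ + (t : ℤ) • e1 ν) μ ν
      = (g t (s + 1) - g t s) - (h s (t + 1) - h s t) := by
    intro s t
    simp only [circ, hg, hh]
    have e1' : x + (s : ℤ) • e1 μ + (t : ℤ) • e1 ν + e1 μ = x + (t : ℤ) • e1 ν + (((s + 1 : ℕ) : ℤ)) • e1 μ := by
      push_cast; rw [add_smul, one_smul]; abel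
    have e2' : x + (s : ℤ) • e1 μ + (t : ℤ) • e1 ν + e1 ν = x + (s : ℤ) • e1 μ + (((t + 1 : ℕ) : ℤ)) • e1 ν := by
      push_cast; rw [add_smul, one_smul]; abel
    have e3' : x + (s : ℤ) • e1 μ + (t : ℤ) • e1 ν = x + (t : ℤ) • e1 ν + (s : ℤ) • e1 μ := by abel
    rw [e1', e2']
    conv_lhs => rw [show Ac (twrap n P (x + (s : ℤ) • e1 μ + (t : ℤ) • e1 ν)) ν
      = Ac (twrap n P (x + (t : ℤ) • e1 ν + (s : ℤ) • e1 μ)) ν by rw [e3']]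
  have hper_g : ∀ t : ℕ, g t (per n P μ) = g t 0 := by
    intro t
    simp only [hg, Nat.cast_zero, zero_smul, add_zero]
    rw [twrap_add_period]
  have hper_h : ∀ s : ℕ, h s (per n P ν) = h s 0 := by
    intro s
    simp only [hh, Nat.cast_zero, zero_smul, add_zero]
    rw [twrap_add_period]
  have hA : ∑ s ∈ range (per n P μ), ∑ t ∈ range (per n P ν), (g t (s + 1) - g t s) = 0 := by
    rw [Finset.sum_comm]
    refine Finset.sum_eq_zero fun t _ => ?_
    rw [Finset.sum_range_sub, hper_g, sub_self]
  have hB : ∑ s ∈ range (per n P μ), ∑ t ∈ range (per n P ν), (h s (t + 1) - h s t) = 0 := by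
    refine Finset.sum_eq_zero fun s _ => ?_
    rw [Finset.sum_range_sub, hper_h, sub_self]
  have hsum : ∑ s ∈ range (per n P μ), ∑ t ∈ range (per n P ν), circ n P Ac (x + (s : ℤ) • e1 μ + (t : ℤ) • e1 ν) μ ν
      = ∑ s ∈ range (per n P μ), ∑ t ∈ range (per n P ν), (g t (s + 1) - g t s)
        - ∑ s ∈ range (per n P μ), ∑ t ∈ range (per n P ν), (h s (t + 1) - h s t) := by
    rw [← Finset.sum_sub_distrib]
    refine Finset.sum_congr rfl fun s _ => ?_
    rw [← Finset.sum_sub_distrib]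
    exact Finset.sum_congr rfl fun t _ => hsplit s t
  rw [hsum, hA, hB, sub_self]

/-! ## §2  Principal angles, winding integers and the integer flux of a component field through a coordinate 2-torus -/

/-- the principal angle of `φ`: its representative in `(−π, π]` (= `arg e^{iφ}`). [cite: Balaban1983RegularityDecay, (1.2) p.572] -/
def pang (φ : ℝ) : ℝ := toIocMod Real.two_pi_pos (-Real.pi) φ

/-- the winding integer of `φ`: `φ = pang φ + 2π·wind φ`. [cite: Balaban1983RegularityDecay, (1.2) p.572] -/
def wind (φ : ℝ) : ℤ := toIocDiv Real.two_pi_pos (-Real.pi) φ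

/-- `pang φ + 2π·wind φ = φ`. [cite: Balaban1983RegularityDecay, (1.2) p.572] -/
theorem pang_add_wind (φ : ℝ) : pang φ + (wind φ : ℝ) * (2 * Real.pi) = φ := by
  have h := toIocMod_add_toIocDiv_zsmul Real.two_pi_pos (-Real.pi) φ
  rw [zsmul_eq_mul] at h
  exact h

/-- `pang φ ∈ (−π, π]`. [cite: Balaban1983RegularityDecay, (1.2) p.572] -/
theorem pang_mem (φ : ℝ) : pang φ ∈ Set.Ioc (-Real.pi) Real.pi := by
  have h := toIocMod_mem_Ioc Real.two_pi_pos (-Real.pi) φ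
  rw [show -Real.pi + 2 * Real.pi = Real.pi by ring] at h
  exact h

/-- `|pang φ| ≤ π`. [cite: Balaban1983RegularityDecay, (1.2) p.572] -/
theorem abs_pang_le (φ : ℝ) : |pang φ| ≤ Real.pi := by
  have h := pang_mem φ
  exact abs_le.2 ⟨h.1.le, h.2⟩

/-- an angle already in `(−π, π]` is its own principal angle. [cite: Balaban1983RegularityDecay, (1.2) p.572] -/
theorem pang_eq_self {φ : ℝ} (h : φ ∈ Set.Ioc (-Real.pi) Real.pi) : pang φ = φ := by
  unfold pang
  rw [toIocMod_eq_self]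
  rw [show -Real.pi + 2 * Real.pi = Real.pi by ring]
  exact h

/-- … and has winding integer `0`. [cite: Balaban1983RegularityDecay, (1.2) p.572] -/
theorem wind_eq_zero_of_mem {φ : ℝ} (h : φ ∈ Set.Ioc (-Real.pi) Real.pi) : wind φ = 0 := by
  have h1 := pang_add_wind φ
  rw [pang_eq_self h] at h1
  have h2 : (wind φ : ℝ) * (2 * Real.pi) = 0 := by linarith
  have h3 : (wind φ : ℝ) = 0 := by
    rcases mul_eq_zero.1 h2 with h | h
    · exact h
    · exfalso; linarith [Real.pi_pos]
  exact_mod_cast h3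

/-- a SMALL angle (`|φ| < π`) has winding integer `0`. [cite: Balaban1983RegularityDecay, (1.7) p.572] -/
theorem wind_eq_zero_of_abs_lt {φ : ℝ} (h : |φ| < Real.pi) : wind φ = 0 :=
  wind_eq_zero_of_mem ⟨by linarith [neg_abs_le φ], (le_abs_self φ).trans h.le⟩

/-- the principal angle is the argument of the phase: `pang φ = arg e^{iφ}`. [cite: Balaban1983RegularityDecay, (1.2) p.572] -/
theorem pang_eq_arg (φ : ℝ) : pang φ = arg (exp (φ * I)) := (Complex.arg_exp_mul_I φ).symm

/-- **the principal angle is a function of the phase**: `e^{iφ} = e^{iψ} ⇒ pang φ = pang ψ` (so everything below depends on the `U(1)`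
plaquette variables only, not on the logarithms chosen). [cite: Balaban1983RegularityDecay, (1.2) p.572] -/
theorem pang_eq_of_cexp_eq {φ ψ : ℝ} (h : exp (φ * I) = exp (ψ * I)) : pang φ = pang ψ := by
  rw [pang_eq_arg, pang_eq_arg, h]

/-- shifting by a full turn does not change the principal angle. [cite: Balaban1983RegularityDecay, (1.2) p.572] -/
theorem pang_sub_two_pi (φ : ℝ) : pang (φ - 2 * Real.pi) = pang φ := by
  apply pang_eq_of_cexp_eq
  rw [show ((φ - 2 * Real.pi : ℝ) : ℂ) * I = φ * I - 2 * Real.pi * I by push_cast; ring, Complex.exp_sub, Complex.exp_two_pi_mul_I,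
    div_one]

/-- the phase of the principal angle is the phase: `e^{i·pang φ} = e^{iφ}`. [cite: Balaban1983RegularityDecay, (1.2) p.572] -/
theorem cexp_pang (φ : ℝ) : exp ((pang φ : ℝ) * I) = exp ((φ : ℝ) * I) := by
  have h := pang_add_wind φ
  conv_rhs => rw [← h]
  push_cast
  rw [add_mul, Complex.exp_add, show ((wind φ : ℤ) : ℂ) * (2 * (Real.pi : ℂ)) * I = (wind φ : ℤ) * (2 * Real.pi * I) by ring,
    Complex.exp_int_mul_two_pi_mul_I, mul_one]

/-- the plaquette VARIABLE is within `|pang|` of `1`: `‖e^{iφ} − 1‖ ≤ |pang φ|`. [cite: BalabanImbrieJaffe1985, (7.3.1) p.326] -/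
theorem norm_cexp_sub_one_le_abs_pang (φ : ℝ) : ‖exp ((φ : ℝ) * I) - 1‖ ≤ |pang φ| := by
  rw [← cexp_pang, mul_comm]
  have h := Real.norm_exp_I_mul_ofReal_sub_one_le (x := pang φ)
  simpa [Real.norm_eq_abs] using h

/-- **THE FLUX of a torus component field through the `(μ, ν)`-coordinate 2-torus through `x`, at coupling `κ`**: minus the sum of the winding
integers of the plaquette angles `κ(dA)(p)` — an INTEGER, equal to `(2π)⁻¹ Σ_p pang(κ(dA)(p))` by Stokes (`flux_mul_two_pi`).
[cite: Balaban1983RegularityDecay, (1.2), (1.7) p.572] -/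
def flux (n : ℕ) (P : Fin (d + 1) → ℕ) (Ac : (Fin (d + 1) → ℤ) → Fin (d + 1) → ℝ) (κ : ℝ) (x : Fin (d + 1) → ℤ) (μ ν : Fin (d + 1)) : ℤ :=
  -∑ s ∈ range (per n P μ), ∑ t ∈ range (per n P ν), wind (κ * circ n P Ac (x + (s : ℤ) • e1 μ + (t : ℤ) • e1 ν) μ ν)

/-- **`2π·flux = Σ_p pang(κ(dA)(p))`** — the principal plaquette angles of a coordinate 2-torus sum to an integer multiple of `2π` (Stokes
`Σ_p (dA)(p) = 0` + `κ(dA)(p) = pang + 2π·wind`). [cite: Balaban1983RegularityDecay, (1.2), (1.7) p.572] -/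
theorem flux_mul_two_pi (n : ℕ) (P : Fin (d + 1) → ℕ) (Ac : (Fin (d + 1) → ℤ) → Fin (d + 1) → ℝ) (κ : ℝ) (x : Fin (d + 1) → ℤ)
    (μ ν : Fin (d + 1)) :
    (flux n P Ac κ x μ ν : ℝ) * (2 * Real.pi)
      = ∑ s ∈ range (per n P μ), ∑ t ∈ range (per n P ν), pang (κ * circ n P Ac (x + (s : ℤ) • e1 μ + (t : ℤ) • e1 ν) μ ν) := by
  have hst := sum_circ_section n P Ac x μ ν
  have key : ∀ s t : ℕ, pang (κ * circ n P Ac (x + (s : ℤ) • e1 μ + (t : ℤ) • e1 ν) μ ν)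
      = κ * circ n P Ac (x + (s : ℤ) • e1 μ + (t : ℤ) • e1 ν) μ ν
        - (wind (κ * circ n P Ac (x + (s : ℤ) • e1 μ + (t : ℤ) • e1 ν) μ ν) : ℝ) * (2 * Real.pi) := by
    intro s t
    have := pang_add_wind (κ * circ n P Ac (x + (s : ℤ) • e1 μ + (t : ℤ) • e1 ν) μ ν)
    linarith
  simp_rw [key, Finset.sum_sub_distrib, ← Finset.mul_sum, ← Finset.sum_mul, hst, mul_zero, zero_sub]
  simp only [flux, Int.cast_neg, Int.cast_sum, neg_mul]

/-- **SMALL PLAQUETTE ANGLES ⇒ ZERO FLUX**: if every `|κ(dA)(p)| < π` on the section then the flux vanishes.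
[cite: Balaban1983RegularityDecay, (1.7) p.572] -/
theorem flux_eq_zero_of_abs_lt {n : ℕ} {P : Fin (d + 1) → ℕ} {Ac : (Fin (d + 1) → ℤ) → Fin (d + 1) → ℝ} {κ : ℝ}
    {x : Fin (d + 1) → ℤ} {μ ν : Fin (d + 1)}
    (h : ∀ s < per n P μ, ∀ t < per n P ν, |κ * circ n P Ac (x + (s : ℤ) • e1 μ + (t : ℤ) • e1 ν) μ ν| < Real.pi) :
    flux n P Ac κ x μ ν = 0 := by
  unfold flux
  rw [neg_eq_zero]
  refine Finset.sum_eq_zero fun s hs => Finset.sum_eq_zero fun t ht => ?_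
  exact wind_eq_zero_of_abs_lt (h s (Finset.mem_range.1 hs) t (Finset.mem_range.1 ht))

/-- **THE FLUX IS A FUNCTION OF THE PLAQUETTE PHASES**: two component fields (at two couplings) with the same plaquette phases
`e^{iκ(dA)(p)} = e^{iκ′(dA′)(p)}` on the section have the same flux — so the flux of a `U(1)` lattice gauge field is well defined, independent
of the gauge and of the logarithms used to present it. [cite: Balaban1983RegularityDecay, (1.2), (1.7) p.572] -/
theorem flux_eq_of_cexp_eq {n : ℕ} {P : Fin (d + 1) → ℕ} {Ac Ac' : (Fin (d + 1) → ℤ) → Fin (d + 1) → ℝ} {κ κ' : ℝ}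
    {x : Fin (d + 1) → ℤ} {μ ν : Fin (d + 1)}
    (h : ∀ s < per n P μ, ∀ t < per n P ν,
      exp ((κ * circ n P Ac (x + (s : ℤ) • e1 μ + (t : ℤ) • e1 ν) μ ν : ℝ) * I)
        = exp ((κ' * circ n P Ac' (x + (s : ℤ) • e1 μ + (t : ℤ) • e1 ν) μ ν : ℝ) * I)) :
    flux n P Ac κ x μ ν = flux n P Ac' κ' x μ ν := by
  have h1 := flux_mul_two_pi n P Ac κ x μ ν
  have h2 := flux_mul_two_pi n P Ac' κ' x μ ν
  have h3 : ∑ s ∈ range (per n P μ), ∑ t ∈ range (per n P ν), pang (κ * circ n P Ac (x + (s : ℤ) • e1 μ + (t : ℤ) • e1 ν) μ ν)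
      = ∑ s ∈ range (per n P μ), ∑ t ∈ range (per n P ν), pang (κ' * circ n P Ac' (x + (s : ℤ) • e1 μ + (t : ℤ) • e1 ν) μ ν) := by
    refine Finset.sum_congr rfl fun s hs => Finset.sum_congr rfl fun t ht => ?_
    exact pang_eq_of_cexp_eq (h s (Finset.mem_range.1 hs) t (Finset.mem_range.1 ht))
  have h4 : (flux n P Ac κ x μ ν : ℝ) * (2 * Real.pi) = (flux n P Ac' κ' x μ ν : ℝ) * (2 * Real.pi) := by rw [h1, h2, h3]
  have h5 : (flux n P Ac κ x μ ν : ℝ) = (flux n P Ac' κ' x μ ν : ℝ) :=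
    mul_right_cancel₀ (by positivity) h4
  exact_mod_cast h5

/-- **LINK-LEVEL GAUGE EQUIVALENCE PRESERVES THE PLAQUETTE PHASES** (abelian cancellation around the plaquette): if on every torus bond
`⟨x, x + e_ν⟩` the link phases satisfy `e^{iκ′A′_ν(x)} = e^{ig(x)}·e^{iκA_ν(x)}·e^{−ig(x+e_ν)}` (a lattice gauge transformation `g`, read
periodically, together with ANY change of logarithms), then the plaquette phases agree. [cite: Balaban1983RegularityDecay, (1.2) p.572, p.580 «the gauge transformation»] -/
theorem cexp_circ_eq_of_linkGauge {n : ℕ} {P : Fin (d + 1) → ℕ} {Ac Ac' : (Fin (d + 1) → ℤ) → Fin (d + 1) → ℝ} {κ κ' : ℝ}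
    (g : (Fin (d + 1) → ℤ) → ℝ)
    (h : ∀ (y : Fin (d + 1) → ℤ) (ν : Fin (d + 1)),
      exp ((κ' * Ac' (twrap n P y) ν : ℝ) * I)
        = exp ((g (twrap n P y) : ℝ) * I) * exp ((κ * Ac (twrap n P y) ν : ℝ) * I) * exp (-((g (twrap n P (y + e1 ν)) : ℝ) * I)))
    (y : Fin (d + 1) → ℤ) (μ ν : Fin (d + 1)) :
    exp ((κ' * circ n P Ac' y μ ν : ℝ) * I) = exp ((κ * circ n P Ac y μ ν : ℝ) * I) := by
  -- normalise the hypothesis: the trailing factor as an inverse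
  have h' : ∀ (z : Fin (d + 1) → ℤ) (ρ : Fin (d + 1)),
      exp ((κ' * Ac' (twrap n P z) ρ : ℝ) * I)
        = exp ((g (twrap n P z) : ℝ) * I) * exp ((κ * Ac (twrap n P z) ρ : ℝ) * I) * (exp ((g (twrap n P (z + e1 ρ)) : ℝ) * I))⁻¹ := by
    intro z ρ
    rw [h z ρ, ← Complex.exp_neg]
  -- the four links of the plaquette, all with base points written through `twrap`
  have hA := h' (y + e1 μ) ν      -- A_ν(y + e_μ)
  have hB := h' y ν               -- A_ν(y)
  have hC := h' (y + e1 ν) μ      -- A_μ(y + e_ν)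
  have hD := h' y μ               -- A_μ(y)
  have hcorner : twrap n P (y + e1 μ + e1 ν) = twrap n P (y + e1 ν + e1 μ) := by rw [add_right_comm]
  -- expand both sides as products of link phases
  have expand : ∀ (κ₀ : ℝ) (A₀ : (Fin (d + 1) → ℤ) → Fin (d + 1) → ℝ),
      exp ((κ₀ * circ n P A₀ y μ ν : ℝ) * I)
        = exp ((κ₀ * A₀ (twrap n P (y + e1 μ)) ν : ℝ) * I) * (exp ((κ₀ * A₀ (twrap n P y) ν : ℝ) * I))⁻¹
          * ((exp ((κ₀ * A₀ (twrap n P (y + e1 ν)) μ : ℝ) * I))⁻¹ * exp ((κ₀ * A₀ (twrap n P y) μ : ℝ) * I)) := by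
    intro κ₀ A₀
    rw [← Complex.exp_neg, ← Complex.exp_neg, ← Complex.exp_add, ← Complex.exp_add, ← Complex.exp_add]
    congr 1
    simp only [circ]
    push_cast
    ring
  rw [expand κ' Ac', expand κ Ac, hA, hB, hC, hD, hcorner]
  field_simp

/-! ## §3  Regular on the whole torus ⇒ zero flux -/

/-- under the forward-difference bound every circulation is at most `2r`. [cite: Balaban1983RegularityDecay, (1.7) p.572] -/
theorem abs_circ_le {n : ℕ} {P : Fin (d + 1) → ℕ} {Ac : (Fin (d + 1) → ℤ) → Fin (d + 1) → ℝ} {r : ℝ}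
    (h : ∀ (x : Fin (d + 1) → ℤ) (μ ν : Fin (d + 1)), |Ac (twrap n P (x + e1 μ)) ν - Ac (twrap n P x) ν| ≤ r)
    (x : Fin (d + 1) → ℤ) (μ ν : Fin (d + 1)) : |circ n P Ac x μ ν| ≤ 2 * r := by
  unfold circ
  have h1 := h x μ ν
  have h2 := h x ν μ
  calc |Ac (twrap n P (x + e1 μ)) ν - Ac (twrap n P x) ν - (Ac (twrap n P (x + e1 ν)) μ - Ac (twrap n P x) μ)|
      ≤ |Ac (twrap n P (x + e1 μ)) ν - Ac (twrap n P x) ν| + |Ac (twrap n P (x + e1 ν)) μ - Ac (twrap n P x) μ| := abs_sub _ _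
    _ ≤ r + r := add_le_add h1 h2
    _ = 2 * r := by ring

/-- **FORWARD DIFFERENCES `≤ r` ON THE WHOLE TORUS WITH `2|κ|r < π` ⇒ ZERO FLUX through every coordinate 2-torus** (the
forward-difference bound `|A_ν(x + e_μ) − A_ν(x)| ≤ r` for all representatives and all `μ, ν`, read through `twrap`, is the shape of (1.7)
with `Ω₀ = T_η` and `r = ce^{β−1}η`). [cite: Balaban1983RegularityDecay, (1.7) p.572] -/
theorem flux_eq_zero_of_diffBound {n : ℕ} {P : Fin (d + 1) → ℕ} {Ac : (Fin (d + 1) → ℤ) → Fin (d + 1) → ℝ} {r κ : ℝ}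
    (h : ∀ (x : Fin (d + 1) → ℤ) (μ ν : Fin (d + 1)), |Ac (twrap n P (x + e1 μ)) ν - Ac (twrap n P x) ν| ≤ r)
    (hκ : 2 * |κ| * r < Real.pi) (x : Fin (d + 1) → ℤ) (μ ν : Fin (d + 1)) :
    flux n P Ac κ x μ ν = 0 := by
  refine flux_eq_zero_of_abs_lt fun s _ t _ => ?_
  rw [abs_mul]
  calc |κ| * |circ n P Ac (x + (s : ℤ) • e1 μ + (t : ℤ) • e1 ν) μ ν| ≤ |κ| * (2 * r) :=
        mul_le_mul_of_nonneg_left (abs_circ_le h _ μ ν) (abs_nonneg κ)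
    _ = 2 * |κ| * r := by ring
    _ < Real.pi := hκ

/-! ## §4  The seam field: plaquette phases within `2π/(N₀N₁)` of `1`, flux `1` -/

section Seam

variable (n : ℕ) (P : Fin (d + 1) → ℕ) (κ : ℝ) (μ₀ ν₀ : Fin (d + 1))

/-- **THE SEAM FIELD** on `T_η` in the plane `(μ₀, ν₀)` (fine periods `N₀ = nP_{μ₀}`, `N₁ = nP_{ν₀}`), at coupling `κ`: the linear potential
`A_{ν₀}(x) = (2π/(κN₀N₁))·x_{μ₀}` of the constant field strength `2π/(N₀N₁)` per plaquette, made periodic by a SEAM of `μ₀`-links on the last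
`μ₀`-slice, `A_{μ₀}(x) = −(2π/(κN₁))·x_{ν₀}` for `x_{μ₀} = N₀ − 1` (all other components `0`); read on representatives.
[cite: Balaban1983RegularityDecay, (1.2) p.572] -/
def seamField : (Fin (d + 1) → ℤ) → Fin (d + 1) → ℝ := fun y ν =>
  if ν = ν₀ then 2 * Real.pi / (κ * (per n P μ₀ : ℕ) * (per n P ν₀ : ℕ)) * (twrap n P y μ₀ : ℝ)
  else if ν = μ₀ ∧ twrap n P y μ₀ = (per n P μ₀ : ℕ) - 1 then -(2 * Real.pi / (κ * (per n P ν₀ : ℕ))) * (twrap n P y ν₀ : ℝ)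
  else 0

variable {n P κ μ₀ ν₀}

/-- the seam field is read through `twrap`: it is periodic. [cite: Balaban1983RegularityDecay, p.572 «periodic conditions»] -/
theorem seamField_twrap (y : Fin (d + 1) → ℤ) : seamField n P κ μ₀ ν₀ (twrap n P y) = seamField n P κ μ₀ ν₀ y := by
  unfold seamField; simp only [twrap_twrap]

/-- coordinate arithmetic of representatives: stepping in direction `μ` changes only the `μ`-coordinate of the representative, to
`(x_μ + 1) mod N_μ`. [cite: Balaban1983RegularityDecay, p.572 «periodic conditions»] -/
theorem twrap_add_e1_apply (y : Fin (d + 1) → ℤ) (μ ν : Fin (d + 1)) :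
    twrap n P (y + e1 μ) ν = if ν = μ then (twrap n P y μ + 1) % (per n P μ : ℕ) else twrap n P y ν := by
  by_cases h : ν = μ
  · subst h
    simp only [if_true, twrap_apply, Pi.add_apply, e1_apply_self]
    rw [Int.emod_add_emod]
  · simp only [h, if_false, twrap_apply, Pi.add_apply, e1_apply_ne h, add_zero]

/-- `(a + 1) mod N` for `0 ≤ a < N`: either `a + 1` (if `a < N − 1`) or `0` (if `a = N − 1`). [folklore] -/
private theorem succ_emod_cases {a : ℤ} {N : ℕ} (h0 : 0 ≤ a) (h1 : a < N) :
    (a < (N : ℤ) - 1 ∧ (a + 1) % (N : ℤ) = a + 1) ∨ (a = (N : ℤ) - 1 ∧ (a + 1) % (N : ℤ) = 0) := by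
  rcases lt_or_eq_of_le (show a ≤ (N : ℤ) - 1 by omega) with hlt | heq
  · left; exact ⟨hlt, Int.emod_eq_of_lt (by omega) (by omega)⟩
  · right; refine ⟨heq, ?_⟩
    rw [show a + 1 = (N : ℤ) by omega]; simp

/-- **THE PLAQUETTE ANGLES OF THE SEAM FIELD IN ITS PLANE**: at every plaquette `(y; μ₀, ν₀)`, `κ·(dA)(p)` is `2π/(N₀N₁)` or
`2π/(N₀N₁) − 2π` (the latter only at the corner of the seam). [cite: Balaban1983RegularityDecay, (1.2) p.572] -/
theorem kappa_circ_seam_plane (hn : 1 ≤ n) (hP : ∀ ν, 1 ≤ P ν) (hκ : κ ≠ 0) (hμν : μ₀ ≠ ν₀) (y : Fin (d + 1) → ℤ) :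
    κ * circ n P (seamField n P κ μ₀ ν₀) y μ₀ ν₀ = 2 * Real.pi / ((per n P μ₀ : ℕ) * (per n P ν₀ : ℕ))
    ∨ κ * circ n P (seamField n P κ μ₀ ν₀) y μ₀ ν₀ = 2 * Real.pi / ((per n P μ₀ : ℕ) * (per n P ν₀ : ℕ)) - 2 * Real.pi := by
  -- names
  set N₀ : ℕ := per n P μ₀ with hN₀
  set N₁ : ℕ := per n P ν₀ with hN₁
  have hN₀1 : 1 ≤ N₀ := B4TorusRegionOp.per_pos hn hP μ₀
  have hN₁1 : 1 ≤ N₁ := B4TorusRegionOp.per_pos hn hP ν₀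
  have hN₀R : (0 : ℝ) < N₀ := by exact_mod_cast hN₀1
  have hN₁R : (0 : ℝ) < N₁ := by exact_mod_cast hN₁1
  set x := twrap n P y with hx
  have hxbox : x ∈ boxDom (per n P) := twrap_mem_boxDom hn hP y
  have hx0 : 0 ≤ x μ₀ ∧ x μ₀ < N₀ := (mem_boxDom.1 hxbox) μ₀
  have hx1 : 0 ≤ x ν₀ ∧ x ν₀ < N₁ := (mem_boxDom.1 hxbox) ν₀
  have hνμ : ν₀ ≠ μ₀ := fun h => hμν h.symm
  -- the four field values entering the circulation
  have hA : seamField n P κ μ₀ ν₀ (twrap n P (y + e1 μ₀)) ν₀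
      = 2 * Real.pi / (κ * N₀ * N₁) * (((x μ₀ + 1) % (N₀ : ℕ) : ℤ) : ℝ) := by
    rw [seamField_twrap]; unfold seamField
    rw [if_pos rfl, twrap_add_e1_apply, if_pos rfl]
  have hB : seamField n P κ μ₀ ν₀ (twrap n P y) ν₀ = 2 * Real.pi / (κ * N₀ * N₁) * (x μ₀ : ℝ) := by
    rw [seamField_twrap]; unfold seamField; rw [if_pos rfl]
  have hC : seamField n P κ μ₀ ν₀ (twrap n P (y + e1 ν₀)) μ₀
      = if x μ₀ = (N₀ : ℤ) - 1 then -(2 * Real.pi / (κ * N₁)) * (((x ν₀ + 1) % (N₁ : ℕ) : ℤ) : ℝ) else 0 := by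
    rw [seamField_twrap]; unfold seamField
    rw [if_neg hμν, twrap_add_e1_apply, if_neg hμν, twrap_add_e1_apply, if_pos rfl]
    by_cases h : x μ₀ = (N₀ : ℤ) - 1
    · rw [if_pos ⟨rfl, h⟩, if_pos h]
    · rw [if_neg (fun h' => h h'.2), if_neg h]
  have hD : seamField n P κ μ₀ ν₀ (twrap n P y) μ₀ = if x μ₀ = (N₀ : ℤ) - 1 then -(2 * Real.pi / (κ * N₁)) * (x ν₀ : ℝ) else 0 := by
    rw [seamField_twrap]; unfold seamField
    rw [if_neg hμν]
    by_cases h : x μ₀ = (N₀ : ℤ) - 1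
    · rw [if_pos ⟨rfl, h⟩, if_pos h]
    · rw [if_neg (fun h' => h h'.2), if_neg h]
  have hcirc : κ * circ n P (seamField n P κ μ₀ ν₀) y μ₀ ν₀
      = κ * ((seamField n P κ μ₀ ν₀ (twrap n P (y + e1 μ₀)) ν₀ - seamField n P κ μ₀ ν₀ (twrap n P y) ν₀)
          - (seamField n P κ μ₀ ν₀ (twrap n P (y + e1 ν₀)) μ₀ - seamField n P κ μ₀ ν₀ (twrap n P y) μ₀)) := rfl
  rw [hcirc, hA, hB, hC, hD]
  rcases succ_emod_cases hx0.1 hx0.2 with ⟨hlt, hmod⟩ | ⟨heq, hmod⟩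
  · -- away from the seam: the linear potential alone
    left
    rw [hmod, if_neg (by omega), if_neg (by omega)]
    push_cast
    field_simp
    ring
  · -- on the seam slice `x_{μ₀} = N₀ − 1`
    rw [hmod, if_pos heq, if_pos heq]
    rcases succ_emod_cases hx1.1 hx1.2 with ⟨hlt1, hmod1⟩ | ⟨heq1, hmod1⟩
    · left
      rw [hmod1, heq]
      push_cast
      field_simp
      ring
    · right
      rw [hmod1, heq, heq1]
      push_cast
      field_simp
      ring

/-- **… so every plaquette PHASE of the seam field in its plane is `e^{2πi/(N₀N₁)}`**. [cite: Balaban1983RegularityDecay, (1.2) p.572] -/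
theorem cexp_circ_seam_plane (hn : 1 ≤ n) (hP : ∀ ν, 1 ≤ P ν) (hκ : κ ≠ 0) (hμν : μ₀ ≠ ν₀) (y : Fin (d + 1) → ℤ) :
    exp ((κ * circ n P (seamField n P κ μ₀ ν₀) y μ₀ ν₀ : ℝ) * I)
      = exp (((2 * Real.pi / ((per n P μ₀ : ℕ) * (per n P ν₀ : ℕ)) : ℝ) : ℂ) * I) := by
  rcases kappa_circ_seam_plane hn hP hκ hμν y with h | h
  · rw [h]
  · rw [h]
    push_cast
    rw [sub_mul, Complex.exp_sub, Complex.exp_two_pi_mul_I, div_one]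

/-- the principal plaquette angle of the seam field in its plane is exactly `2π/(N₀N₁)` (when `N₀N₁ ≥ 2`).
[cite: Balaban1983RegularityDecay, (1.2) p.572] -/
theorem pang_circ_seam_plane (hn : 1 ≤ n) (hP : ∀ ν, 1 ≤ P ν) (hκ : κ ≠ 0) (hμν : μ₀ ≠ ν₀)
    (hN : 2 ≤ per n P μ₀ * per n P ν₀) (y : Fin (d + 1) → ℤ) :
    pang (κ * circ n P (seamField n P κ μ₀ ν₀) y μ₀ ν₀) = 2 * Real.pi / ((per n P μ₀ : ℕ) * (per n P ν₀ : ℕ)) := by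
  have hNR : (2 : ℝ) ≤ (per n P μ₀ : ℕ) * (per n P ν₀ : ℕ) := by exact_mod_cast hN
  have hmem : 2 * Real.pi / ((per n P μ₀ : ℕ) * (per n P ν₀ : ℕ)) ∈ Set.Ioc (-Real.pi) Real.pi := by
    have hpos : 0 < 2 * Real.pi / ((per n P μ₀ : ℕ) * (per n P ν₀ : ℕ)) := by positivity
    refine ⟨by linarith [Real.pi_pos], ?_⟩
    rw [div_le_iff₀ (by positivity)]
    nlinarith [Real.pi_pos]
  rcases kappa_circ_seam_plane hn hP hκ hμν y with h | h
  · rw [h, pang_eq_self hmem]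
  · rw [h, pang_sub_two_pi, pang_eq_self hmem]

/-- **THE SEAM FIELD HAS FLUX `1`** through every `(μ₀, ν₀)`-coordinate 2-torus (`N₀N₁ ≥ 2`, `κ ≠ 0`).
[cite: Balaban1983RegularityDecay, (1.2), (1.7) p.572] -/
theorem flux_seam (hn : 1 ≤ n) (hP : ∀ ν, 1 ≤ P ν) (hκ : κ ≠ 0) (hμν : μ₀ ≠ ν₀) (hN : 2 ≤ per n P μ₀ * per n P ν₀)
    (x : Fin (d + 1) → ℤ) : flux n P (seamField n P κ μ₀ ν₀) κ x μ₀ ν₀ = 1 := by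
  have h := flux_mul_two_pi n P (seamField n P κ μ₀ ν₀) κ x μ₀ ν₀
  simp_rw [pang_circ_seam_plane hn hP hκ hμν hN] at h
  rw [Finset.sum_const, Finset.card_range, Finset.sum_const, Finset.card_range, nsmul_eq_mul, nsmul_eq_mul] at h
  have hN₀ : (0 : ℝ) < (per n P μ₀ : ℕ) := by exact_mod_cast B4TorusRegionOp.per_pos hn hP μ₀
  have hN₁ : (0 : ℝ) < (per n P ν₀ : ℕ) := by exact_mod_cast B4TorusRegionOp.per_pos hn hP ν₀
  have h2 : (flux n P (seamField n P κ μ₀ ν₀) κ x μ₀ ν₀ : ℝ) * (2 * Real.pi) = 1 * (2 * Real.pi) := by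
    rw [h]; field_simp
  have h3 : (flux n P (seamField n P κ μ₀ ν₀) κ x μ₀ ν₀ : ℝ) = 1 := mul_right_cancel₀ (by positivity) h2
  exact_mod_cast h3

/-- off its plane the seam field is curl-free: `(dA)(y; μ, ν) = 0` unless `{μ, ν} = {μ₀, ν₀}`.
[cite: Balaban1983RegularityDecay, (1.2) p.572] -/
theorem circ_seam_eq_zero_of_not_mem {μ ν : Fin (d + 1)} (hμ : μ ≠ μ₀ ∧ μ ≠ ν₀ ∨ ν ≠ μ₀ ∧ ν ≠ ν₀)
    (y : Fin (d + 1) → ℤ) : circ n P (seamField n P κ μ₀ ν₀) y μ ν = 0 := by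
  -- a step in a direction `ρ ∉ {μ₀, ν₀}` does not move the `μ₀`- and `ν₀`-coordinates of the representative
  have step : ∀ {ρ : Fin (d + 1)}, ρ ≠ μ₀ → ρ ≠ ν₀ → ∀ (z : Fin (d + 1) → ℤ) (c : Fin (d + 1)),
      seamField n P κ μ₀ ν₀ (twrap n P (z + e1 ρ)) c = seamField n P κ μ₀ ν₀ (twrap n P z) c := by
    intro ρ h0 h1 z c
    rw [seamField_twrap, seamField_twrap]
    unfold seamField
    rw [twrap_add_e1_apply, if_neg h0.symm, twrap_add_e1_apply, if_neg h1.symm]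
  -- and the `ρ`-component vanishes identically
  have zero : ∀ {ρ : Fin (d + 1)}, ρ ≠ μ₀ → ρ ≠ ν₀ → ∀ z : Fin (d + 1) → ℤ, seamField n P κ μ₀ ν₀ z ρ = 0 := by
    intro ρ h0 h1 z
    unfold seamField
    rw [if_neg h1, if_neg (fun h => h0 h.1)]
  rcases hμ with ⟨h0, h1⟩ | ⟨h0, h1⟩
  · unfold circ
    rw [step h0 h1, zero h0 h1, zero h0 h1]; ring
  · unfold circ
    rw [step h0 h1, zero h0 h1, zero h0 h1]; ring

/-- **ALL PLAQUETTE ANGLES OF THE SEAM FIELD ARE SMALL**: `|pang(κ(dA)(p))| ≤ 2π/(N₀N₁)` at EVERY plaquette of the torus (in the plane: `=`;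
in the transposed plane: the opposite phase; elsewhere: `0`) — the plaquette variables are uniformly within angle `2π/(N₀N₁)` of `1`, as small
as one wishes on a large torus. [cite: Balaban1983RegularityDecay, (1.2), (1.7) p.572] -/
theorem abs_pang_circ_seam_le (hn : 1 ≤ n) (hP : ∀ ν, 1 ≤ P ν) (hκ : κ ≠ 0) (hμν : μ₀ ≠ ν₀) (hN : 2 ≤ per n P μ₀ * per n P ν₀)
    (y : Fin (d + 1) → ℤ) (μ ν : Fin (d + 1)) :
    |pang (κ * circ n P (seamField n P κ μ₀ ν₀) y μ ν)| ≤ 2 * Real.pi / ((per n P μ₀ : ℕ) * (per n P ν₀ : ℕ)) := by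
  have hNR : (2 : ℝ) ≤ (per n P μ₀ : ℕ) * (per n P ν₀ : ℕ) := by exact_mod_cast hN
  have hprod : (0 : ℝ) < (per n P μ₀ : ℕ) * (per n P ν₀ : ℕ) := by linarith
  have hpos : 0 ≤ 2 * Real.pi / ((per n P μ₀ : ℕ) * (per n P ν₀ : ℕ)) := by positivity
  have hzero : pang 0 = 0 := pang_eq_self ⟨by linarith [Real.pi_pos], Real.pi_pos.le⟩
  -- tiny tori (`N₀N₁ = 2`): the bound is `≥ π`, which every principal angle obeys
  by_cases htiny : ((per n P μ₀ : ℕ) : ℝ) * (per n P ν₀ : ℕ) ≤ 2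
  · refine (abs_pang_le _).trans ?_
    rw [le_div_iff₀ hprod]
    nlinarith [Real.pi_pos]
  have hbig : (2 : ℝ) < (per n P μ₀ : ℕ) * (per n P ν₀ : ℕ) := lt_of_not_ge htiny
  have hlt : 2 * Real.pi / ((per n P μ₀ : ℕ) * (per n P ν₀ : ℕ)) < Real.pi := by
    rw [div_lt_iff₀ hprod]; nlinarith [Real.pi_pos]
  by_cases h1 : μ = μ₀ ∧ ν = ν₀
  · -- the plane itself
    rw [h1.1, h1.2, pang_circ_seam_plane hn hP hκ hμν hN y, abs_of_nonneg hpos]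
  by_cases h2 : μ = ν₀ ∧ ν = μ₀
  · -- the transposed plane: the opposite angle
    rw [h2.1, h2.2, circ_swap, mul_neg]
    have hneg : exp (((-(κ * circ n P (seamField n P κ μ₀ ν₀) y μ₀ ν₀) : ℝ) : ℂ) * I)
        = exp (((-(2 * Real.pi / ((per n P μ₀ : ℕ) * (per n P ν₀ : ℕ)))) : ℝ) * I) := by
      have h1' := cexp_circ_seam_plane hn hP hκ hμν y
      push_cast at h1' ⊢
      rw [neg_mul, neg_mul, Complex.exp_neg, Complex.exp_neg, h1']
    rw [pang_eq_of_cexp_eq hneg]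
    have hmem : -(2 * Real.pi / ((per n P μ₀ : ℕ) * (per n P ν₀ : ℕ))) ∈ Set.Ioc (-Real.pi) Real.pi :=
      ⟨by linarith, by linarith⟩
    rw [pang_eq_self hmem, abs_neg, abs_of_nonneg hpos]
  by_cases h3 : μ = ν
  · rw [h3, show circ n P (seamField n P κ μ₀ ν₀) y ν ν = 0 by unfold circ; ring, mul_zero, hzero, abs_zero]
    exact hpos
  -- otherwise one of the two directions is outside the plane
  have h4 : (μ ≠ μ₀ ∧ μ ≠ ν₀) ∨ (ν ≠ μ₀ ∧ ν ≠ ν₀) := by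
    by_cases ha : μ = μ₀
    · right; exact ⟨fun hb => h3 (ha.trans hb.symm), fun hb => h1 ⟨ha, hb⟩⟩
    · by_cases hb : μ = ν₀
      · right; exact ⟨fun hc => h2 ⟨hb, hc⟩, fun hc => h3 (hb.trans hc.symm)⟩
      · left; exact ⟨ha, hb⟩
  rw [circ_seam_eq_zero_of_not_mem h4, mul_zero, hzero, abs_zero]
  exact hpos

/-- **THE SEAM FIELD'S PLAQUETTE VARIABLES ARE UNIFORMLY CLOSE TO `1`**: `‖u(∂p) − 1‖ ≤ 2π/(N₀N₁)` for the `U(1)` plaquette variables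
`u(∂p) = e^{iκ(dA)(p)}` at EVERY plaquette — the shape of [BalabanImbrieJaffe1985]'s small-field condition (7.3.1) `|v(∂p) − 1| ≤ e_k𝓅(e_k)`,
met as soon as `N₀N₁ ≥ 2π/(e_k𝓅(e_k))`. [cite: BalabanImbrieJaffe1985, (7.3.1) p.326] -/
theorem norm_plaqVar_seam_sub_one_le (hn : 1 ≤ n) (hP : ∀ ν, 1 ≤ P ν) (hκ : κ ≠ 0) (hμν : μ₀ ≠ ν₀)
    (hN : 2 ≤ per n P μ₀ * per n P ν₀) (y : Fin (d + 1) → ℤ) (μ ν : Fin (d + 1)) :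
    ‖exp ((κ * circ n P (seamField n P κ μ₀ ν₀) y μ ν : ℝ) * I) - 1‖ ≤ 2 * Real.pi / ((per n P μ₀ : ℕ) * (per n P ν₀ : ℕ)) :=
  (norm_cexp_sub_one_le_abs_pang _).trans (abs_pang_circ_seam_le hn hP hκ hμν hN y μ ν)

/-- **(7.3.1)-SHAPED SMALLNESS WITH FLUX ONE**: for every `ε > 0` and every torus whose `(μ₀, ν₀)`-plane has `N₀N₁ ≥ 2π/ε` fine plaquettes,
the seam field's plaquette variables satisfy `‖u(∂p) − 1‖ ≤ ε` at every plaquette while the `(μ₀, ν₀)`-flux is `1` — nonzero-flux sectors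
are admitted by any plaquette-smallness condition of the form (7.3.1) on large tori. [cite: BalabanImbrieJaffe1985, (7.3.1) p.326] -/
theorem seam_plaqVar_le_of_large (hn : 1 ≤ n) (hP : ∀ ν, 1 ≤ P ν) (hκ : κ ≠ 0) (hμν : μ₀ ≠ ν₀) {ε : ℝ} (hε : 0 < ε)
    (hN : 2 ≤ per n P μ₀ * per n P ν₀) (hlarge : 2 * Real.pi / ε ≤ (per n P μ₀ : ℕ) * (per n P ν₀ : ℕ))
    (y : Fin (d + 1) → ℤ) (μ ν : Fin (d + 1)) :
    ‖exp ((κ * circ n P (seamField n P κ μ₀ ν₀) y μ ν : ℝ) * I) - 1‖ ≤ ε := by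
  refine (norm_plaqVar_seam_sub_one_le hn hP hκ hμν hN y μ ν).trans ?_
  have hprod : (0 : ℝ) < (per n P μ₀ : ℕ) * (per n P ν₀ : ℕ) := by
    have : (2 : ℝ) ≤ (per n P μ₀ : ℕ) * (per n P ν₀ : ℕ) := by exact_mod_cast hN
    linarith
  rw [div_le_iff₀ hprod]
  rw [div_le_iff₀ hε] at hlarge
  nlinarith

end Seam

/-! ## §5  The obstruction in r01's typed currency: `(torusPairFam …).regular` fails on the whole torus at nonzero flux -/

section Typed

variable {ι : Type} [Fintype ι] [DecidableEq ι]
variable {ℓ : ℕ} {amin aplus m2plus : ℝ}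

/-- **(1.7) ON `Ω₀ = T_η` ⇒ THE FORWARD-DIFFERENCE BOUND ON THE WHOLE TORUS** with `r = c·e^{β−1}/n`: r01's typed hypothesis slot
`(torusPairFam …).regular`, when the larger region `Ω₀` is the whole torus, bounds every forward difference of the component field.
[cite: Balaban1983RegularityDecay, (1.7) p.572] -/
theorem diffBound_of_regular (F : OrthFlow ι) {creg β : ℝ} {K : ℕ} (i : TorusPairInst d ℓ amin aplus m2plus)
    (hΩ₀ : fineDom ((ℓ + 1) ^ i.k) i.Ω₀T = boxDom (per ((ℓ + 1) ^ i.k) i.P))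
    (h : (torusPairFam F d ℓ amin aplus m2plus creg β K i).regular) (x : Fin (d + 1) → ℤ) (μ ν : Fin (d + 1)) :
    |i.Ac (twrap ((ℓ + 1) ^ i.k) i.P (x + e1 μ)) ν - i.Ac (twrap ((ℓ + 1) ^ i.k) i.P x) ν|
      ≤ creg * i.e ^ (β - 1) / ((ℓ + 1) ^ i.k : ℕ) := by
  have hn : 1 ≤ (ℓ + 1) ^ i.k := Nat.one_le_pow _ _ (Nat.succ_pos ℓ)
  have hx : twrap ((ℓ + 1) ^ i.k) i.P x ∈ fineDom ((ℓ + 1) ^ i.k) i.Ω₀T := by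
    rw [hΩ₀]; exact twrap_mem_boxDom hn i.hP x
  have h1 := h (twrap ((ℓ + 1) ^ i.k) i.P x) hx μ ν
  rwa [twrap_twrap_add] at h1

/-- **THE OBSTRUCTION**: on the whole torus (`Ω₀ = T_η`), at coupling `0 < e` with `2c·e^β < π·n²` (`n = L^k`; this holds for EVERY
`e ≤ (π/2c)^{1/β}` since `n ≥ 1` — i.e. precisely «for e sufficiently small», where the Theorem is used), NO instance whose component field
has a nonzero flux through some coordinate 2-torus satisfies r01's typed (1.7)-slot `(torusPairFam …).regular`.
[cite: Balaban1983RegularityDecay, (1.7) p.572, Theorem p.573 «for e sufficiently small and for a regular vector field A»] -/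
theorem not_regular_of_flux_ne_zero (F : OrthFlow ι) {creg β : ℝ} {K : ℕ} (i : TorusPairInst d ℓ amin aplus m2plus)
    (hΩ₀ : fineDom ((ℓ + 1) ^ i.k) i.Ω₀T = boxDom (per ((ℓ + 1) ^ i.k) i.P)) (he : 0 < i.e)
    (hsmall : 2 * creg * i.e ^ β < Real.pi * (((ℓ + 1) ^ i.k : ℕ) : ℝ) ^ 2)
    {x : Fin (d + 1) → ℤ} {μ ν : Fin (d + 1)} (hflux : flux ((ℓ + 1) ^ i.k) i.P i.Ac i.κ x μ ν ≠ 0) :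
    ¬ (torusPairFam F d ℓ amin aplus m2plus creg β K i).regular := by
  intro hreg
  apply hflux
  have hD := diffBound_of_regular F i hΩ₀ hreg
  refine flux_eq_zero_of_diffBound hD ?_ x μ ν
  have hn : (1 : ℝ) ≤ (((ℓ + 1) ^ i.k : ℕ) : ℝ) := by exact_mod_cast Nat.one_le_pow _ _ (Nat.succ_pos ℓ)
  have hnpos : (0 : ℝ) < (((ℓ + 1) ^ i.k : ℕ) : ℝ) := by linarith
  have hκ : |i.κ| = i.e / (((ℓ + 1) ^ i.k : ℕ) : ℝ) := by
    show |i.e / (((ℓ + 1) ^ i.k : ℕ) : ℝ)| = _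
    rw [abs_of_pos (div_pos he hnpos)]
  have hpow : i.e * i.e ^ (β - 1) = i.e ^ β := by
    rw [Real.rpow_sub_one he.ne', mul_div_cancel₀ _ he.ne']
  rw [hκ]
  have : 2 * (i.e / (((ℓ + 1) ^ i.k : ℕ) : ℝ)) * (creg * i.e ^ (β - 1) / (((ℓ + 1) ^ i.k : ℕ) : ℝ))
      = 2 * creg * i.e ^ β / (((ℓ + 1) ^ i.k : ℕ) : ℝ) ^ 2 := by
    rw [← hpow]; field_simp
  rw [this, div_lt_iff₀ (by positivity)]
  exact hsmall

/-- **THE SEAM PHASES ADMIT NO REGULAR PRESENTATION ON THE WHOLE TORUS, IN ANY GAUGE, WITH ANY LOGARITHMS**: an instance on `Ω₀ = T_η`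
(`0 < e`, `2c·e^β < π·n²`, fine periods with `N₀N₁ ≥ 2` in a plane `μ₀ ≠ ν₀`) whose component field reproduces the plaquette PHASES of the
seam field — in particular (by `cexp_circ_eq_of_linkGauge`) any lattice gauge transform of it with any choice of logarithms — is NOT
`regular`, although these plaquette phases are all within angle `2π/(N₀N₁)` of `1` (`abs_pang_circ_seam_le`).  So r01's torus Theorem
`B4ThmTorusPairEta.thmPrintedNN_torusPairFam` with `Ω₀ = T_η` has NO instance at such a background: the «whole-torus» item of HOME/GAPS.md
G-C1-05 ADD. 12 is outside [7]'s printed hypothesis, and [BalabanImbrieJaffe1985] p. 326's «in a local region Λ» is necessary.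
[cite: BalabanImbrieJaffe1985, (7.3.1) p.326 «by change of gauge u_k can be transformed in a local region Λ into … exp[ie_kηA]»] -/
theorem not_regular_of_seamPhases (F : OrthFlow ι) {creg β : ℝ} {K : ℕ} (i : TorusPairInst d ℓ amin aplus m2plus)
    (hΩ₀ : fineDom ((ℓ + 1) ^ i.k) i.Ω₀T = boxDom (per ((ℓ + 1) ^ i.k) i.P)) (he : 0 < i.e)
    (hsmall : 2 * creg * i.e ^ β < Real.pi * (((ℓ + 1) ^ i.k : ℕ) : ℝ) ^ 2)
    {μ₀ ν₀ : Fin (d + 1)} (hμν : μ₀ ≠ ν₀) (hN : 2 ≤ per ((ℓ + 1) ^ i.k) i.P μ₀ * per ((ℓ + 1) ^ i.k) i.P ν₀) {κ₀ : ℝ} (hκ₀ : κ₀ ≠ 0)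
    (x : Fin (d + 1) → ℤ)
    (hphase : ∀ s < per ((ℓ + 1) ^ i.k) i.P μ₀, ∀ t < per ((ℓ + 1) ^ i.k) i.P ν₀,
      exp ((i.κ * circ ((ℓ + 1) ^ i.k) i.P i.Ac (x + (s : ℤ) • e1 μ₀ + (t : ℤ) • e1 ν₀) μ₀ ν₀ : ℝ) * I)
        = exp ((κ₀ * circ ((ℓ + 1) ^ i.k) i.P (seamField ((ℓ + 1) ^ i.k) i.P κ₀ μ₀ ν₀) (x + (s : ℤ) • e1 μ₀ + (t : ℤ) • e1 ν₀) μ₀ ν₀ : ℝ)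
            * I)) :
    ¬ (torusPairFam F d ℓ amin aplus m2plus creg β K i).regular := by
  have hn : 1 ≤ (ℓ + 1) ^ i.k := Nat.one_le_pow _ _ (Nat.succ_pos ℓ)
  refine not_regular_of_flux_ne_zero F i hΩ₀ he hsmall (x := x) (μ := μ₀) (ν := ν₀) ?_
  rw [flux_eq_of_cexp_eq hphase, flux_seam hn i.hP hκ₀ hμν hN x]
  exact one_ne_zero

/-- **EXISTENCE, UNCONDITIONALLY** (the headline, quantifier form): for every torus with a coordinate plane of `N₀N₁ ≥ 2` fine plaquettes and
every nonzero coupling there is a component field (the seam field) all of whose plaquette angles are at most `2π/(N₀N₁)` in absolute value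
— so its plaquette variables satisfy any prescribed (7.3.1)-type smallness once the torus is large — and whose flux through the plane is `1`;
by `not_regular_of_flux_ne_zero` / `flux_eq_of_cexp_eq` no (1.7)-regular field on the whole torus presents these plaquette variables when
`2c·e^β < π·n²`. [cite: BalabanImbrieJaffe1985, (7.3.1) p.326; Balaban1983RegularityDecay, (1.7) p.572] -/
theorem exists_smallCurvature_flux_one {n : ℕ} (hn : 1 ≤ n) {P : Fin (d + 1) → ℕ} (hP : ∀ ν, 1 ≤ P ν) {κ : ℝ} (hκ : κ ≠ 0)
    {μ₀ ν₀ : Fin (d + 1)} (hμν : μ₀ ≠ ν₀) (hN : 2 ≤ per n P μ₀ * per n P ν₀) :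
    ∃ Ac : (Fin (d + 1) → ℤ) → Fin (d + 1) → ℝ,
      (∀ y μ ν, |pang (κ * circ n P Ac y μ ν)| ≤ 2 * Real.pi / ((per n P μ₀ : ℕ) * (per n P ν₀ : ℕ)))
      ∧ (∀ y μ ν, ‖exp ((κ * circ n P Ac y μ ν : ℝ) * I) - 1‖ ≤ 2 * Real.pi / ((per n P μ₀ : ℕ) * (per n P ν₀ : ℕ)))
      ∧ ∀ x, flux n P Ac κ x μ₀ ν₀ = 1 :=
  ⟨seamField n P κ μ₀ ν₀, fun y μ ν => abs_pang_circ_seam_le hn hP hκ hμν hN y μ ν,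
    fun y μ ν => norm_plaqVar_seam_sub_one_le hn hP hκ hμν hN y μ ν, fun x => flux_seam hn hP hκ hμν hN x⟩

/-- dictionary to r01's rotation-matrix currency (`OrthFlow.rot`, `U(1)` read as `SO(2)`): equal plaquette ROTATIONS `R(s) = R(t)` force equal
phases `e^{is} = e^{it}` (the converse is `BIJ85RegionPropagatorsActualBg.rot_U_eq_of_circleExp_eq`), so hypotheses on plaquette variables
may be given in either currency. [cite: Balaban1983RegularityDecay, (1.2) p.572] -/
theorem cexp_eq_of_rot_eq {s t : ℝ} (h : OrthFlow.rot.U s = OrthFlow.rot.U t) : exp ((s : ℂ) * I) = exp ((t : ℂ) * I) := by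
  have hc : Real.cos s = Real.cos t := by
    have := congrFun (congrFun h 0) 0
    simpa [OrthFlow.rot] using this
  have hs : Real.sin s = Real.sin t := by
    have := congrFun (congrFun h 1) 0
    simpa [OrthFlow.rot] using this
  rw [Complex.exp_mul_I, Complex.exp_mul_I, ← Complex.ofReal_cos, ← Complex.ofReal_sin, ← Complex.ofReal_cos, ← Complex.ofReal_sin, hc, hs]

end Typed

/-! ## §6  Non-vacuity in r01's own family: whole-torus instances meeting `bigBlocks ∧ rect` with tiny curvature but NOT `regular` -/

section Unmet

variable {ι : Type} [Fintype ι] [DecidableEq ι]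

/-- **WHOLE-TORUS HYPOTHESES UNMET** — the counterpart of r01's non-vacuity `B4ThmTorusPairEta.hypotheses_met`: for every dimension
`d + 1 ≥ 2`, every `L = ℓ + 1`, windows, (1.7)-constants `(c, β)`, big-block size `K ≥ 1`, torus size `M ≥ 3` (in big blocks) and EVERY
coupling `0 < e` with `2c·e^β < π`, there is an instance of r01's torus family at scale `k = 1` with `Ω = Ω₀ = T_η` (so `rect` and
`bigBlocks` hold) whose component field is the seam field: ALL its plaquette variables are within `2π/(LKM)²` of `1` — as small as one
wishes (`M → ∞`) — and yet `(torusPairFam …).regular` is FALSE.  So the typed torus Theorem cannot be applied on the whole torus to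
this background, in any gauge (`not_regular_of_seamPhases`). [cite: Balaban1983RegularityDecay, (1.7) p.572, Theorem p.573; BalabanImbrieJaffe1985, (7.3.1) p.326] -/
theorem wholeTorus_hypotheses_unmet (F : OrthFlow ι) (hd : 1 ≤ d) (ℓ : ℕ) {amin aplus m2plus : ℝ} (hap : amin ≤ aplus)
    (hm : 0 ≤ m2plus) (creg β : ℝ) {K : ℕ} (hK : 1 ≤ K) {M : ℕ} (hM : 3 ≤ M) {e : ℝ} (he : 0 < e)
    (hsmall : 2 * creg * e ^ β < Real.pi) :
    ∃ i : TorusPairInst d ℓ amin aplus m2plus,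
      i.e = e ∧ i.k = 1 ∧ (i.P = fun _ => K * M) ∧
      (torusPairFam F d ℓ amin aplus m2plus creg β K i).rect ∧
      (torusPairFam F d ℓ amin aplus m2plus creg β K i).bigBlocks ∧
      fineDom ((ℓ + 1) ^ i.k) i.Ω₀T = boxDom (per ((ℓ + 1) ^ i.k) i.P) ∧
      (∀ y μ ν, ‖exp ((i.κ * circ ((ℓ + 1) ^ i.k) i.P i.Ac y μ ν : ℝ) * I) - 1‖
          ≤ 2 * Real.pi / ((((ℓ + 1) * (K * M) : ℕ) : ℝ) * (((ℓ + 1) * (K * M) : ℕ) : ℝ))) ∧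
      ¬ (torusPairFam F d ℓ amin aplus m2plus creg β K i).regular := by
  -- two distinct directions
  let μ₀ : Fin (d + 1) := ⟨0, by omega⟩
  let ν₀ : Fin (d + 1) := ⟨1, by omega⟩
  have hμν : μ₀ ≠ ν₀ := by
    intro h; have := congrArg Fin.val h; simp [μ₀, ν₀] at this
  have hn : 1 ≤ (ℓ + 1) ^ 1 := Nat.one_le_pow _ _ (Nat.succ_pos ℓ)
  have hKM : 1 ≤ K * M := Nat.one_le_iff_ne_zero.2 (Nat.mul_ne_zero (by omega) (by omega))
  have h3 : ∀ ν : Fin (d + 1), 3 ≤ per ((ℓ + 1) ^ 1) (fun _ : Fin (d + 1) => K * M) ν := by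
    intro ν
    show 3 ≤ (ℓ + 1) ^ 1 * (K * M)
    calc 3 ≤ 1 * (1 * 3) := by norm_num
      _ ≤ (ℓ + 1) ^ 1 * (K * M) := Nat.mul_le_mul hn (Nat.mul_le_mul hK hM)
  let κ₀ : ℝ := e / ((ℓ + 1) ^ 1 : ℕ)
  have hκ₀ : κ₀ ≠ 0 := by
    have : (0 : ℝ) < ((ℓ + 1) ^ 1 : ℕ) := by exact_mod_cast hn
    exact (div_pos he this).ne'
  let i0 : TorusPairInst d ℓ amin aplus m2plus :=
    { k := 1
      hk := le_rfl
      P := fun _ => K * M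
      hP := fun _ => hKM
      h3 := h3
      Ω₀T := boxDom fun _ => K * M
      ΩT := boxDom fun _ => K * M
      hbox := Finset.Subset.refl _
      hsub := Finset.Subset.refl _
      a := amin
      m2 := 0
      ha1 := le_rfl
      ha2 := hap
      hm1 := le_rfl
      hm2 := hm
      Ac := seamField ((ℓ + 1) ^ 1) (fun _ => K * M) κ₀ μ₀ ν₀
      e := e }
  have hrect : fineDom ((ℓ + 1) ^ 1) (boxDom fun _ : Fin (d + 1) => K * M) = boxDom (per ((ℓ + 1) ^ 1) fun _ => K * M) := by
    rw [B4Lower18.fineDom_boxDom hn]; rfl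
  have hN : 2 ≤ per ((ℓ + 1) ^ 1) (fun _ : Fin (d + 1) => K * M) μ₀ * per ((ℓ + 1) ^ 1) (fun _ : Fin (d + 1) => K * M) ν₀ :=
    le_trans (by norm_num) (Nat.mul_le_mul (h3 μ₀) (h3 ν₀))
  have hκi : i0.κ = κ₀ := rfl
  refine ⟨i0, rfl, rfl, rfl, hrect, ?_, hrect, ?_, ?_⟩
  · -- bigBlocks: the whole torus is a union of `K`-blocks and `K ∣ KM`
    refine ⟨?_, ?_, fun _ => Dvd.intro M rfl⟩ <;>
      exact B4Lower18.boxDom_isBlockUnion hK (fun _ : Fin (d + 1) => M)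
  · -- every plaquette variable is within `2π/(LKM)²` of `1`
    intro y μ ν
    have h := norm_plaqVar_seam_sub_one_le (n := (ℓ + 1) ^ 1) (P := fun _ : Fin (d + 1) => K * M) (κ := κ₀) hn (fun _ => hKM)
      hκ₀ hμν hN y μ ν
    have hper : ∀ ρ : Fin (d + 1), ((per ((ℓ + 1) ^ 1) (fun _ : Fin (d + 1) => K * M) ρ : ℕ) : ℝ) = (((ℓ + 1) * (K * M) : ℕ) : ℝ) := by
      intro ρ; simp [per]
    rw [hper μ₀, hper ν₀] at h
    exact h
  · -- not regular: the flux of the seam field is `1 ≠ 0`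
    refine not_regular_of_flux_ne_zero F i0 hrect he ?_ (x := 0) (μ := μ₀) (ν := ν₀) ?_
    · have h1 : (1 : ℝ) ≤ ((((ℓ + 1) ^ 1 : ℕ) : ℝ)) := by exact_mod_cast hn
      calc 2 * creg * e ^ β < Real.pi := hsmall
        _ = Real.pi * 1 ^ 2 := by ring
        _ ≤ Real.pi * ((((ℓ + 1) ^ 1 : ℕ) : ℝ)) ^ 2 := by gcongr
    · show flux ((ℓ + 1) ^ 1) (fun _ : Fin (d + 1) => K * M) (seamField ((ℓ + 1) ^ 1) (fun _ => K * M) κ₀ μ₀ ν₀) i0.κ 0 μ₀ ν₀ ≠ 0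
      rw [hκi, flux_seam hn (fun _ => hKM) hκ₀ hμν hN]
      exact one_ne_zero

end Unmet

end

end Literature.MathematicalPhysics.QuantumFieldTheory.BalabanImbrieJaffe1984to88.BIJ85GlobalGaugeObstruction326
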